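import Literature.NumberTheory.EllipticCurves.BurungaleKobayashiNakamuraOta2026.AnticyclotomicRankGrowth
import Literature.NumberTheory.EllipticCurves.RohrlichAnticyclotomicRootNumber
import HarnessLib

set_option linter.dupNamespace false

/-!
# Route `RamifiedSevenEllipticUnits` (K7r), Value crux `EllipticUnitValueSevenOfGZK`
# (stmt-BirchSwinnertonDyer-19945), line `rubin-formula-zp`: WHY THE CHARACTER DIRECTION IS EMPTY —
# for a prime `p ≡ 3 (mod 4)` ramified in the CM field, [BKNO] (1.1) at `a ≡ −1` flips the sign, so of
# the two central values `L(φχ, 1)`, `L(φχ̄, 1)` one always vanishes (cell `bsd-cm`, seat `bsd-cm-k7r-c2`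
# g6; THEOREMS ONLY, relative to the printed claim binder `eqn11_rootNumber_pow_OPEN`; nothing asserted,
# no item closed, BSD not claimed)

HONEST FRAMING. A helper RECORD for the line card of `rubin-formula-zp` (planner D123): it supports, and
does not close, stmt-BirchSwinnertonDyer-19945. Content (memo NOTE-k7r-c2-g6-TORIC (C3), evidence #27
on 19945):

* §1 (unconditional, complex analysis only): a central root number `W ≠ 1` in the sense of the tree's
  `IsCentralRootNumber χ W` forces a CENTRAL ZERO of the entire continuation of `L(s, χ)`:
  `Λ(1) = W·Λ(1)` gives `Λ(1) = 0`, and `Λ(s)/(Γ(s)B^s)` is an entire continuation of `L(s, χ)` from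
  `re s > 3/2` (`1/Γ` is entire) vanishing at `s = 1` —
  `exists_continuation_central_zero_of_isCentralRootNumber_ne_one`.
* §2 (relative to [BKNO] (1.1) = `eqn11_rootNumber_pow_OPEN`, PREPRINT claim binder, entered as a
  HYPOTHESIS `h11`): for `p ≡ 3 (mod 4)` and a nontrivial level-`≤ n` anticyclotomic character `χ`,
  the Galois-conjugate power `χ^{p^{n+1} − 1}` (`≡ χ⁻¹ = χ̄` once `χ^{p^n} = 1`) has the OPPOSITE sign:
  `W(φχ^{p^{n+1}−1}) = −W(φχ)`, because `(p^{n+1} − 1 / p) = (−1/p) = −1`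
  (`isCentralRootNumber_conjPow_neg_of_eqn11_OPEN`); hence ONE of `L(s, φχ)`, `L(s, φχ^{p^{n+1}−1})`
  has a central zero (`central_zero_or_conjPow_central_zero_of_eqn11_OPEN`). For `K = ℚ(√−7)`, `p = 7`
  this is the statement that every anticyclotomic Rankin–Selberg central value
  `L(f_E/K, χ, 1) = L(φχ, 1)·L(φχ̄, 1)` with `χ ≠ 1` of `7`-power order VANISHES — the «character
  direction» of any Gross-point / square-root anticyclotomic measure for `(E, K)` is identically zero,
  so the WEIGHT direction of D123 is the only interpolation route to the trivial character.

PARTITION: CornerF-ramified@7 (B13/O11) × 𝒞₇ × 7 — types-the-object-of (sign bookkeeping); closes no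
cell, no item. References: [BurungaleKobayashiNakamuraOta2026] arXiv:2608.06879 §1.1 (1.1), Lemma 4.4
(2) (preprint; claim binder); [Jia2026ActaArith] §2 (3)–(5) (the functional equation normalisation
behind `IsCentralRootNumber`); [Rohrlich1984Anticyclotomic] Theorem p. 384.
-/

noncomputable section

open scoped Classical

open WeierstrassCurve NumberField
  Literature.NumberTheory.EllipticCurves
  Literature.NumberTheory.EllipticCurves.BurungaleKobayashiNakamuraOta2026
  Literature.NumberTheory.GaloisRepresentations

namespace Summit.BirchSwinnertonDyer.BirchSwinnertonDyer.Theorems.RamifiedSevenEllipticUnits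

namespace ConjugateTwistSign

/-! ### §1. A root number `≠ 1` forces a central zero (unconditional) -/

section CentralZero

variable {K : Type} [Field K] [NumberField K]

/-- **A central root number `W ≠ 1` forces a central zero.** If `Λ(s) = Γ(s)B^s L(s, χ)` (on
`re s > 3/2`) extends to an entire function with `Λ(s) = W·Λ(2 − s)` and `W ≠ 1`, then `Λ(1) = 0`,
and `F(s) := Λ(s)·Γ(s)⁻¹·B^{−s}` is an entire continuation of `L(s, χ)` from `re s > 3/2`
(`IsEntireContinuationWt2 χ F`) with `F(1) = 0`. In particular root number `−1` gives a central zero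
(the trivial half of Rohrlich's dichotomy). [cite: Jia2026ActaArith, §2 (3)–(5)] -/
theorem exists_continuation_central_zero_of_isCentralRootNumber_ne_one {χ : HeckeCharacter K}
    {W : ℂ} (h : IsCentralRootNumber χ W) (hW : W ≠ 1) :
    ∃ F : ℂ → ℂ, IsEntireContinuationWt2 χ F ∧ F 1 = 0 := by
  obtain ⟨B, hB, Λ, hΛd, hΛL, hΛfe⟩ := h
  have hBC : (B : ℂ) ≠ 0 := by exact_mod_cast hB.ne'
  -- `Λ(1) = W Λ(1)` with `W ≠ 1` forces `Λ(1) = 0`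
  have hΛ1 : Λ 1 = 0 := by
    have h1 := hΛfe 1
    rw [show (2 : ℂ) - 1 = 1 by norm_num] at h1
    have h2 : (1 - W) * Λ 1 = 0 := by linear_combination h1
    exact (mul_eq_zero.1 h2).resolve_left (sub_ne_zero.2 (Ne.symm hW))
  refine ⟨fun s ↦ Λ s * (Complex.Gamma s)⁻¹ * (B : ℂ) ^ (-s), ⟨?_, ?_⟩, ?_⟩
  · -- entire: `Λ`, `1/Γ` and `B^{−s}` are entire
    intro s
    have hcpow : DifferentiableAt ℂ (fun s : ℂ ↦ (B : ℂ) ^ (-s)) s :=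
      differentiableAt_id.neg.const_cpow (Or.inl hBC)
    exact ((hΛd s).mul (Complex.differentiable_one_div_Gamma s)).mul hcpow
  · -- agrees with `L(s, χ)` on `re s > 3/2`
    intro s hs
    have hΓ : Complex.Gamma s ≠ 0 := Complex.Gamma_ne_zero_of_re_pos (by linarith)
    have hBs : (B : ℂ) ^ s ≠ 0 := by
      intro h0
      exact hBC ((Complex.cpow_eq_zero_iff _ _).1 h0).1
    simp only
    rw [hΛL s hs, Complex.cpow_neg]
    field_simp
  · -- vanishes at `s = 1`
    simp only
    rw [hΛ1, zero_mul, zero_mul]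

/-- Root number `−1` gives a central zero of the continuation of `L(s, χ)`.
[cite: Jia2026ActaArith, §2 (3)–(5)] -/
theorem exists_continuation_central_zero_of_isCentralRootNumber_neg_one {χ : HeckeCharacter K}
    (h : IsCentralRootNumber χ (-1)) : ∃ F : ℂ → ℂ, IsEntireContinuationWt2 χ F ∧ F 1 = 0 :=
  exists_continuation_central_zero_of_isCentralRootNumber_ne_one h (by norm_num)

end CentralZero

/-! ### §2. [BKNO] (1.1) at `a ≡ −1 (mod p)` for `p ≡ 3 (mod 4)`: the conjugate twist has the
opposite sign, so one of the two central values vanishes -/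

section ConjugatePower

/-- `p ∤ p^{n+1} − 1`. [folklore] -/
theorem not_dvd_pow_succ_sub_one {p : ℕ} (hp : p.Prime) (n : ℕ) : ¬ p ∣ p ^ (n + 1) - 1 := by
  intro h
  have hle : 1 ≤ p ^ (n + 1) := Nat.one_le_pow _ _ hp.pos
  have hpow : p ∣ p ^ (n + 1) - 1 + 1 := by
    rw [Nat.sub_add_cancel hle]
    exact dvd_pow_self p (Nat.succ_ne_zero n)
  exact hp.one_lt.ne' (Nat.dvd_one.1 ((Nat.dvd_add_right h).1 hpow))

/-- `((p^{n+1} − 1) / p) = (−1/p) = −1` for a prime `p ≡ 3 (mod 4)`. [folklore] -/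
theorem legendreSym_pow_succ_sub_one {p : ℕ} [hp : Fact p.Prime] (hp3 : p % 4 = 3) (n : ℕ) :
    legendreSym p ((p ^ (n + 1) - 1 : ℕ) : ℤ) = -1 := by
  have hp2 : p ≠ 2 := by
    rintro rfl
    norm_num at hp3
  have hle : 1 ≤ p ^ (n + 1) := Nat.one_le_pow _ _ hp.out.pos
  have hcast : ((p ^ (n + 1) - 1 : ℕ) : ℤ) = -1 + (p : ℤ) * (p : ℤ) ^ n := by
    rw [Nat.cast_sub hle, Nat.cast_pow, Nat.cast_one, pow_succ]
    ring
  rw [hcast, legendreSym.mod p, Int.add_mul_emod_self_left, ← legendreSym.mod p,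
    legendreSym.at_neg_one hp2, ZMod.χ₄_nat_three_mod_four hp3]

/-- **[BKNO] (1.1) at `a = p^{n+1} − 1 ≡ −1`: for `p ≡ 3 (mod 4)` the conjugate twist has the OPPOSITE
root number.** Granted (1.1) (`eqn11_rootNumber_pow_OPEN`, hypothesis `h11`): in its frame (`E/ℚ` with
CM by `𝒪_K`, `φ` its Hecke character, `p` odd ramified in `K`, `χ ≠ 1` an anticyclotomic character of
level `≤ n`), if moreover `p ≡ 3 (mod 4)` and `W(φχ) = w`, then `W(φχ^{p^{n+1}−1}) = −w` — since
`p ∤ p^{n+1} − 1` and `((p^{n+1} − 1)/p) = (−1/p) = −1`. (When `χ^{p^n} = 1`, `χ^{p^{n+1}−1} = χ⁻¹ = χ̄`.)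
For `K = ℚ(√−7)`, `p = 7`: `ε(φχ̄) = −ε(φχ)` for every non-trivial `χ` of `7`-power order.
[claim: BurungaleKobayashiNakamuraOta2026, status: under-review] -/
theorem isCentralRootNumber_conjPow_neg_of_eqn11_OPEN (h11 : eqn11_rootNumber_pow_OPEN)
    (W : WeierstrassCurve ℚ) [W.IsElliptic] (hj : W.j ∈ maximalCMJInvariants)
    (K : Type) [Field K] [NumberField K] (hK : IsCMFieldOfJ K W.j) (c : K ≃ₐ[ℚ] K) (hc : c ≠ 1)
    (φ : HeckeCharacter K) (hφ : φ.HasInfinityType (fun _ ↦ 1) (fun _ ↦ 0))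
    (heq : IsHeckeConjEquivariant c φ) (hL : ∀ s : ℂ, 3 / 2 < s.re → heckeLFunction φ s = W.LSeries s)
    (p : ℕ) [Fact p.Prime] (hp3 : p % 4 = 3) (hram : (p : ℤ) ∣ cmFieldDiscr W.j)
    (κ : ZpExtension K p) (hκ : κ.IsAnticyclotomic) (ι : PadicAlgCl p ≃+* ℂ) (n : ℕ)
    (χ : HeckeCharacter K) (r : FramedGaloisRep K (PadicAlgCl p) 1) (hχ : IsAcCharacter ι κ n χ r)
    (hne : χ ≠ 1) (w : ℂ) (hw : IsCentralRootNumber (φ * χ) w) :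
    IsCentralRootNumber (φ * χ ^ (p ^ (n + 1) - 1)) (-w) := by
  have hp2 : p ≠ 2 := by
    rintro rfl
    norm_num at hp3
  have h := h11 W hj K hK c hc φ hφ heq hL p hp2 hram κ hκ ι n χ r hχ hne (p ^ (n + 1) - 1)
    (not_dvd_pow_succ_sub_one (Fact.out) n) w hw
  rwa [legendreSym_pow_succ_sub_one hp3 n, Int.cast_neg, Int.cast_one, neg_one_mul] at h

/-- **Hence one of the pair `L(s, φχ)`, `L(s, φχ^{p^{n+1}−1})` has a CENTRAL ZERO** (granted (1.1);
`p ≡ 3 (mod 4)`, `χ ≠ 1` of level `≤ n`, and `φχ` has SOME central root number `w`): if `w ≠ 1` the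
first vanishes at `s = 1` (§1), otherwise the conjugate power has root number `−1` and vanishes there.
For `K = ℚ(√−7)`, `p = 7` this is (C3) of NOTE-k7r-c2-g6-TORIC: every anticyclotomic Rankin–Selberg
central value `L(f_E/K, χ, 1) = L(φχ,1)·L(φχ̄,1)`, `χ ≠ 1` of `7`-power order, VANISHES — the character
direction of any central-value anticyclotomic measure for `(E, K)` is identically zero.
[claim: BurungaleKobayashiNakamuraOta2026, status: under-review] -/
theorem central_zero_or_conjPow_central_zero_of_eqn11_OPEN (h11 : eqn11_rootNumber_pow_OPEN)
    (W : WeierstrassCurve ℚ) [W.IsElliptic] (hj : W.j ∈ maximalCMJInvariants)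
    (K : Type) [Field K] [NumberField K] (hK : IsCMFieldOfJ K W.j) (c : K ≃ₐ[ℚ] K) (hc : c ≠ 1)
    (φ : HeckeCharacter K) (hφ : φ.HasInfinityType (fun _ ↦ 1) (fun _ ↦ 0))
    (heq : IsHeckeConjEquivariant c φ) (hL : ∀ s : ℂ, 3 / 2 < s.re → heckeLFunction φ s = W.LSeries s)
    (p : ℕ) [Fact p.Prime] (hp3 : p % 4 = 3) (hram : (p : ℤ) ∣ cmFieldDiscr W.j)
    (κ : ZpExtension K p) (hκ : κ.IsAnticyclotomic) (ι : PadicAlgCl p ≃+* ℂ) (n : ℕ)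
    (χ : HeckeCharacter K) (r : FramedGaloisRep K (PadicAlgCl p) 1) (hχ : IsAcCharacter ι κ n χ r)
    (hne : χ ≠ 1) (w : ℂ) (hw : IsCentralRootNumber (φ * χ) w) :
    (∃ F : ℂ → ℂ, IsEntireContinuationWt2 (φ * χ) F ∧ F 1 = 0) ∨
      (∃ F : ℂ → ℂ, IsEntireContinuationWt2 (φ * χ ^ (p ^ (n + 1) - 1)) F ∧ F 1 = 0) := by
  by_cases hw1 : w = 1
  · subst hw1
    exact Or.inr (exists_continuation_central_zero_of_isCentralRootNumber_neg_one
      (isCentralRootNumber_conjPow_neg_of_eqn11_OPEN h11 W hj K hK c hc φ hφ heq hL p hp3 hram κ hκ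
        ι n χ r hχ hne 1 hw))
  · exact Or.inl (exists_continuation_central_zero_of_isCentralRootNumber_ne_one hw hw1)

end ConjugatePower

end ConjugateTwistSign

end Summit.BirchSwinnertonDyer.BirchSwinnertonDyer.Theorems.RamifiedSevenEllipticUnits

end
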